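import Mathlib
import Summits.Parity.BatemanHorn.Theorems.IsogenyRedeiTypeIMainTermDesmooth
import HarnessLib

/-!
# Type-I main term for Bateman–Horn (stmt-Parity-0873), input A2 (part 2):
# `∑_{n ≤ x} μ(n) (ρ_f(n)/n) log n = −C(f) + O(exp(−c√log x))`

For `f ∈ ℤ[X]` irreducible of positive degree with positive leading coefficient and no fixed
prime divisor, and `C(f) = ∏_p (1 − 1/p)^{-1}(1 − ρ_f(p)/p)` its Bateman–Horn constant
(`batemanHornConst ![f]`):

* `moebius_rootDensity_sums_aux` — rates for `S(x) = ∑_{n ≤ x} μ(n)ρ_f(n)/n`,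
  `R(x) = ∑_{n ≤ x} μ(n)(ρ_f(n)/n) log n` (`R = (log x)S − ℛ`) and the log-Riesz means `ℛ`;
* `sum_primesLE_rootDensity_loglog` — Mertens' second theorem for `ρ_f` with rate
  (Friedlander–Iwaniec's hypothesis (1.9) for `g = rootDensity f`), from the tree's
  `DegreeOnePrimes.sum_primesLE_rootCount_div_eq` for the monic normalisation;
* `moebius_rootDensity_sums` — **the engine of the Type-I main term**: `C(f) > 0` and
  `|S(x)| ≤ C e^{−c√log x}`, `|R(x) + C(f)| ≤ C e^{−c√log x}` (`x ≥ 1`); the value `−C(f)` is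
  Friedlander–Iwaniec (1.13)–(1.14) (the tree's `fi_moebius_density_log_sum_holds`).

Everything here is proved.
-/

noncomputable section

open Filter Finset Polynomial ArithmeticFunction Complex
open scoped ArithmeticFunction.Moebius ArithmeticFunction.omega Topology

namespace Summit.Parity.BatemanHorn.Theorems.TypeIMainTerm

open Literature.NumberTheory.Sieve Literature.NumberTheory.LFunctions

/-! ### The log-weighted sums `∑_{n ≤ x} μ(n) (ρ_f(n)/n) log n` -/

/-- **Sharp and log-weighted Möbius–root-density sums with de la Vallée-Poussin rates.** For `f`
irreducible of positive degree there are `c₀`, `c > 0`, `C ≥ 0` such that for all `x ≥ 1`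
`|S(x)| ≤ C e^{−c√log x}`, `|R(x) + c₀| ≤ C e^{−c√log x}` and `|ℛ(x) − c₀| ≤ C e^{−c√log x}`,
where `S(x) = ∑_{n ≤ x} μ(n)ρ_f(n)/n`, `R(x) = ∑_{n ≤ x} μ(n)(ρ_f(n)/n) log n`,
`ℛ(x) = ∑_{n ≤ x} μ(n)(ρ_f(n)/n) log(x/n)` (`R = (log x) S − ℛ`). -/
theorem moebius_rootDensity_sums_aux {f : ℤ[X]} (hirr : Irreducible f) (hdeg : 1 ≤ f.natDegree) :
    ∃ c₀ c C : ℝ, 0 < c ∧ 0 ≤ C ∧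
      (∀ x : ℝ, 1 ≤ x → |∑ n ∈ Icc 1 ⌊x⌋₊, (μ n : ℝ) * rootDensity f n| ≤
        C * Real.exp (-c * Real.sqrt (Real.log x))) ∧
      (∀ x : ℝ, 1 ≤ x → |∑ n ∈ Icc 1 ⌊x⌋₊, (μ n : ℝ) * rootDensity f n * Real.log n + c₀| ≤
        C * Real.exp (-c * Real.sqrt (Real.log x))) ∧
      (∀ x : ℝ, 1 ≤ x → |∑ n ∈ Icc 1 ⌊x⌋₊, (μ n : ℝ) * rootDensity f n * Real.log (x / n) - c₀| ≤
        C * Real.exp (-c * Real.sqrt (Real.log x))) := by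
  obtain ⟨c₀, c, C_R, hc, hR⟩ := abs_logRieszMean_moebius_rootDensity_sub_le hirr hdeg
  obtain ⟨c', C_S, hc', hS⟩ := abs_sum_moebius_rootDensity_le hirr hdeg
  have hC_R : 0 ≤ C_R := by simpa using (abs_nonneg _).trans (hR 1 le_rfl)
  have hC_S : 0 ≤ C_S := by simpa using (abs_nonneg _).trans (hS 1 le_rfl)
  set a : ℝ := c' / 2 with ha
  have ha0 : 0 < a := half_pos hc'
  set c₁ : ℝ := min a c with hc₁
  have hc₁0 : 0 < c₁ := lt_min ha0 hc
  set M : ℝ := 24 / a ^ 4 + 1 with hM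
  have hM0 : 0 ≤ M := by positivity
  set C : ℝ := C_S * M + C_R + C_S with hC
  refine ⟨c₀, c₁, C, hc₁0, by positivity, fun x hx => ?_, fun x hx => ?_, fun x hx => ?_⟩
  · -- `S`
    refine (hS x hx).trans ?_
    have h1 : Real.exp (-c' * Real.sqrt (Real.log x)) ≤ Real.exp (-c₁ * Real.sqrt (Real.log x)) :=
      Real.exp_le_exp.mpr (by nlinarith [Real.sqrt_nonneg (Real.log x), min_le_left a c])
    calc C_S * Real.exp (-c' * Real.sqrt (Real.log x)) ≤ C_S * Real.exp (-c₁ * Real.sqrt (Real.log x)) :=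
          mul_le_mul_of_nonneg_left h1 hC_S
      _ ≤ C * Real.exp (-c₁ * Real.sqrt (Real.log x)) := by
          refine mul_le_mul_of_nonneg_right ?_ (Real.exp_nonneg _)
          rw [hC]; nlinarith
  · -- `R = (log x) S − ℛ`
    have hx0 : 0 < x := by linarith
    have hid : ∑ n ∈ Icc 1 ⌊x⌋₊, (μ n : ℝ) * rootDensity f n * Real.log n =
        Real.log x * ∑ n ∈ Icc 1 ⌊x⌋₊, (μ n : ℝ) * rootDensity f n -
          ∑ n ∈ Icc 1 ⌊x⌋₊, (μ n : ℝ) * rootDensity f n * Real.log (x / n) := by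
      rw [Finset.mul_sum, ← Finset.sum_sub_distrib]
      refine Finset.sum_congr rfl fun n hn => ?_
      have hn : (0 : ℝ) < n := by exact_mod_cast (Finset.mem_Icc.mp hn).1
      rw [Real.log_div hx0.ne' hn.ne']
      ring
    rw [hid]
    have hlog0 : 0 ≤ Real.log x := Real.log_nonneg hx
    set u := Real.sqrt (Real.log x) with hu
    have hu0 : 0 ≤ u := Real.sqrt_nonneg _
    have e1 : Real.log x * ∑ n ∈ Icc 1 ⌊x⌋₊, (μ n : ℝ) * rootDensity f n -
          ∑ n ∈ Icc 1 ⌊x⌋₊, (μ n : ℝ) * rootDensity f n * Real.log (x / n) + c₀ =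
        Real.log x * ∑ n ∈ Icc 1 ⌊x⌋₊, (μ n : ℝ) * rootDensity f n -
          (∑ n ∈ Icc 1 ⌊x⌋₊, (μ n : ℝ) * rootDensity f n * Real.log (x / n) - c₀) := by ring
    rw [e1]
    refine (abs_sub _ _).trans ?_
    rw [abs_mul, abs_of_nonneg hlog0]
    have h1 : Real.log x * |∑ n ∈ Icc 1 ⌊x⌋₊, (μ n : ℝ) * rootDensity f n| ≤
        C_S * M * Real.exp (-a * u) := by
      calc Real.log x * |∑ n ∈ Icc 1 ⌊x⌋₊, (μ n : ℝ) * rootDensity f n|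
          ≤ Real.log x * (C_S * Real.exp (-c' * u)) := mul_le_mul_of_nonneg_left (hS x hx) hlog0
        _ = C_S * (Real.log x * Real.exp (-(a * u))) * Real.exp (-a * u) := by
            have e2 : Real.exp (-c' * u) = Real.exp (-(a * u)) * Real.exp (-a * u) := by
              rw [← Real.exp_add]; congr 1; rw [ha]; ring
            rw [e2]; ring
        _ ≤ C_S * M * Real.exp (-a * u) := by
            refine mul_le_mul_of_nonneg_right (mul_le_mul_of_nonneg_left ?_ hC_S) (Real.exp_nonneg _)
            exact MoebiusLogSum.log_mul_exp_neg_mul_sqrt_le ha0 hx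
    have h2 : |∑ n ∈ Icc 1 ⌊x⌋₊, (μ n : ℝ) * rootDensity f n * Real.log (x / n) - c₀| ≤
        C_R * Real.exp (-c * u) := hR x hx
    have h3 : Real.exp (-a * u) ≤ Real.exp (-c₁ * u) :=
      Real.exp_le_exp.mpr (by nlinarith [min_le_left a c])
    have h4 : Real.exp (-c * u) ≤ Real.exp (-c₁ * u) :=
      Real.exp_le_exp.mpr (by nlinarith [min_le_right a c])
    calc Real.log x * |∑ n ∈ Icc 1 ⌊x⌋₊, (μ n : ℝ) * rootDensity f n| +
          |∑ n ∈ Icc 1 ⌊x⌋₊, (μ n : ℝ) * rootDensity f n * Real.log (x / n) - c₀|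
        ≤ C_S * M * Real.exp (-c₁ * u) + C_R * Real.exp (-c₁ * u) :=
          add_le_add (h1.trans (mul_le_mul_of_nonneg_left h3 (by positivity)))
            (h2.trans (mul_le_mul_of_nonneg_left h4 hC_R))
      _ ≤ C * Real.exp (-c₁ * u) := by
          rw [hC]; nlinarith [Real.exp_nonneg (-c₁ * u)]
  · -- `ℛ`
    refine (hR x hx).trans ?_
    have h1 : Real.exp (-c * Real.sqrt (Real.log x)) ≤ Real.exp (-c₁ * Real.sqrt (Real.log x)) :=
      Real.exp_le_exp.mpr (by nlinarith [Real.sqrt_nonneg (Real.log x), min_le_right a c])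
    calc C_R * Real.exp (-c * Real.sqrt (Real.log x)) ≤ C_R * Real.exp (-c₁ * Real.sqrt (Real.log x)) :=
          mul_le_mul_of_nonneg_left h1 hC_R
      _ ≤ C * Real.exp (-c₁ * Real.sqrt (Real.log x)) := by
          refine mul_le_mul_of_nonneg_right ?_ (Real.exp_nonneg _)
          rw [hC]; nlinarith

/-! ### Identification of the constant: `c₀ = C(f)`, the Bateman–Horn constant of `f` -/

/-- **Mertens' second theorem for `ρ_f` with rate** (hypothesis (1.9) of Friedlander–Iwaniec for
`g = rootDensity f`): for `f` irreducible of positive degree,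
`∑_{p ≤ y} ρ_f(p)/p = log log y + c + O((log y)^{-10})` (`y ≥ 2`). From the tree's
`DegreeOnePrimes.sum_primesLE_rootCount_div_eq` for the monic integral normalisation `g₁` of `f`
(`ρ_{g₁}(p) = ρ_f(p)` for `p ∤ lc f`). -/
theorem sum_primesLE_rootDensity_loglog {f : ℤ[X]} (hirr : Irreducible f) (hdeg : 1 ≤ f.natDegree) :
    ∃ c K : ℝ, ∀ y : ℝ, 2 ≤ y →
      |(∑ p ∈ Nat.primesLE ⌊y⌋₊, rootDensity f p) - (Real.log (Real.log y) + c)| ≤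
        K / Real.log y ^ 10 := by
  classical
  set g₁ : ℤ[X] := integralNormalization f with hg₁
  have hmon : g₁.Monic := monic_integralNormalization hirr.ne_zero
  have hirr₁ : Irreducible g₁ := irreducible_integralNormalization hirr hdeg
  obtain ⟨c, K, hK⟩ := DegreeOnePrimes.sum_primesLE_rootCount_div_eq hmon hirr₁ 9
  have hlc : f.leadingCoeff ≠ 0 := leadingCoeff_ne_zero.mpr hirr.ne_zero
  set PF := f.leadingCoeff.natAbs.primeFactors with hPF
  set δ : ℕ → ℝ := fun p => rootDensity f p - (polyRootCountMod ![g₁] p : ℝ) / p with hδ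
  have hδ0 : ∀ p : ℕ, p.Prime → p ∉ PF → δ p = 0 := by
    intro p hp hpF
    have hplc : ¬(p : ℤ) ∣ f.leadingCoeff := fun h =>
      hpF (Nat.mem_primeFactors.mpr ⟨hp, Int.natCast_dvd.mp h, Int.natAbs_ne_zero.mpr hlc⟩)
    simp only [hδ]
    rw [rootDensity_apply, hg₁, polyRootCountMod_integralNormalization hdeg hp hplc, sub_self]
  have hδ2 : ∀ p : ℕ, |δ p| ≤ 2 := by
    intro p
    simp only [hδ]
    refine (abs_sub _ _).trans ?_
    have h1 : |rootDensity f p| ≤ 1 := by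
      rw [abs_of_nonneg (rootDensity_nonneg f p)]; exact rootDensity_le_one f p
    have h2 : |(polyRootCountMod ![g₁] p : ℝ) / p| ≤ 1 := by
      have := rootDensity_le_one g₁ p
      have h0 := rootDensity_nonneg g₁ p
      rw [rootDensity_apply] at this h0
      rw [abs_of_nonneg h0]; exact this
    linarith
  set D : ℝ := ∑ p ∈ PF, δ p with hD
  set M : ℝ := Real.log ((f.leadingCoeff.natAbs : ℝ) + 1) with hMdef
  refine ⟨c + D, K + 2 * PF.card * M ^ 10, fun y hy => ?_⟩
  have hy0 : 0 < y := by linarith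
  have hlogy : 0 < Real.log y := Real.log_pos (by linarith)
  have hmain := hK y hy
  simp_rw [← polyRootCountMod_single] at hmain
  -- decompose the sum
  have hsum : ∑ p ∈ Nat.primesLE ⌊y⌋₊, rootDensity f p =
      ∑ p ∈ Nat.primesLE ⌊y⌋₊, (polyRootCountMod ![g₁] p : ℝ) / p +
        ∑ p ∈ Nat.primesLE ⌊y⌋₊, δ p := by
    rw [← Finset.sum_add_distrib]; exact Finset.sum_congr rfl fun p _ => by simp [hδ]
  -- the correction sum lives on `PF`
  have hcorr : ∑ p ∈ Nat.primesLE ⌊y⌋₊, δ p = ∑ p ∈ PF.filter (fun p => p ≤ ⌊y⌋₊), δ p := by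
    rw [← Finset.sum_filter_of_ne (p := fun p => p ∈ PF) (fun p hp hne => by
      by_contra h; exact hne (hδ0 p (Nat.prime_of_mem_primesLE hp) h))]
    refine Finset.sum_congr ?_ fun _ _ => rfl
    ext p
    simp only [Finset.mem_filter, Nat.mem_primesLE]
    constructor
    · rintro ⟨⟨h1, -⟩, h3⟩; exact ⟨h3, h1⟩
    · rintro ⟨h1, h2⟩; exact ⟨⟨h2, Nat.prime_of_mem_primeFactors h1⟩, h1⟩
  have hDsplit : D = ∑ p ∈ PF.filter (fun p => p ≤ ⌊y⌋₊), δ p +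
      ∑ p ∈ PF.filter (fun p => ¬p ≤ ⌊y⌋₊), δ p := by
    rw [hD, Finset.sum_filter_add_sum_filter_not]
  -- the tail of the correction is small compared with `(log y)^{-10}`
  have htail : |∑ p ∈ PF.filter (fun p => ¬p ≤ ⌊y⌋₊), δ p| ≤ 2 * PF.card * M ^ 10 / Real.log y ^ 10 := by
    rcases (PF.filter (fun p => ¬p ≤ ⌊y⌋₊)).eq_empty_or_nonempty with he | hne
    · rw [he, Finset.sum_empty, abs_zero]; positivity
    · -- some `p ∈ PF` exceeds `⌊y⌋`, so `y ≤ |lc f| + 1` and `log y ≤ M`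
      obtain ⟨q, hq⟩ := hne
      rw [Finset.mem_filter, not_le] at hq
      have hqlc : q ≤ f.leadingCoeff.natAbs := Nat.le_of_mem_primeFactors hq.1
      have hylt : y < q + 1 := by
        have := Nat.lt_of_floor_lt hq.2
        have h2 : y < ⌊y⌋₊ + 1 := Nat.lt_floor_add_one y
        have h3 : (⌊y⌋₊ : ℝ) + 1 ≤ q := by exact_mod_cast hq.2
        linarith
      have hyM : Real.log y ≤ M := by
        refine Real.log_le_log hy0 ?_
        have : (q : ℝ) ≤ f.leadingCoeff.natAbs := by exact_mod_cast hqlc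
        linarith
      have hratio : 1 ≤ M ^ 10 / Real.log y ^ 10 := by
        rw [le_div_iff₀ (by positivity), one_mul]
        exact pow_le_pow_left₀ hlogy.le hyM 10
      calc |∑ p ∈ PF.filter (fun p => ¬p ≤ ⌊y⌋₊), δ p|
          ≤ ∑ p ∈ PF.filter (fun p => ¬p ≤ ⌊y⌋₊), |δ p| := Finset.abs_sum_le_sum_abs _ _
        _ ≤ ∑ p ∈ PF.filter (fun p => ¬p ≤ ⌊y⌋₊), (2 : ℝ) := Finset.sum_le_sum fun p _ => hδ2 p
        _ ≤ ∑ p ∈ PF, (2 : ℝ) :=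
            Finset.sum_le_sum_of_subset_of_nonneg (Finset.filter_subset _ _) fun _ _ _ => by norm_num
        _ = 2 * PF.card := by rw [Finset.sum_const, nsmul_eq_mul, mul_comm]
        _ ≤ 2 * PF.card * (M ^ 10 / Real.log y ^ 10) :=
            le_mul_of_one_le_right (by positivity) hratio
        _ = 2 * PF.card * M ^ 10 / Real.log y ^ 10 := by ring
  rw [hsum, hcorr]
  have e1 : ∑ p ∈ Nat.primesLE ⌊y⌋₊, (polyRootCountMod ![g₁] p : ℝ) / p +
        ∑ p ∈ PF.filter (fun p => p ≤ ⌊y⌋₊), δ p - (Real.log (Real.log y) + (c + D)) =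
      (∑ p ∈ Nat.primesLE ⌊y⌋₊, (polyRootCountMod ![g₁] p : ℝ) / p - (Real.log (Real.log y) + c)) -
        ∑ p ∈ PF.filter (fun p => ¬p ≤ ⌊y⌋₊), δ p := by rw [hDsplit]; ring
  rw [e1, add_div]
  exact (abs_sub _ _).trans (add_le_add hmain htail)

/-- **Sharp and log-weighted Möbius–root-density sums, with the constant identified.** For
`f ∈ ℤ[X]` irreducible of positive degree with positive leading coefficient and no fixed prime
divisor (`ρ_f(p) < p` for all `p`), let `C(f) = ∏_p (1 − 1/p)^{-1}(1 − ρ_f(p)/p)` be the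
Bateman–Horn constant of `f` (`batemanHornConst ![f]`, an ordered conditionally convergent product,
positive by `IsBatemanHornSystem.hasBatemanHornConst_holds`). Then there are `c > 0`, `C ≥ 0` with,
for all real `x ≥ 1`,
`|∑_{n ≤ x} μ(n) ρ_f(n)/n| ≤ C e^{−c√log x}` and `|∑_{n ≤ x} μ(n) (ρ_f(n)/n) log n + C(f)| ≤ C e^{−c√log x}`.
The value `−C(f)` of the log-weighted series is Friedlander–Iwaniec's (1.13)–(1.14) (the tree's
`fi_moebius_density_log_sum_holds`, whose hypothesis (1.9) is `sum_primesLE_rootDensity_loglog`);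
the rates come from `moebius_rootDensity_sums_aux`. -/
theorem moebius_rootDensity_sums {f : ℤ[X]} (hirr : Irreducible f) (hdeg : 1 ≤ f.natDegree)
    (hlc : 0 < f.leadingCoeff) (hnfd : ∀ p : ℕ, p.Prime → polyRootCountMod ![f] p < p) :
    0 < batemanHornConst ![f] ∧ ∃ c C : ℝ, 0 < c ∧ 0 ≤ C ∧
      (∀ x : ℝ, 1 ≤ x → |∑ n ∈ Icc 1 ⌊x⌋₊, (μ n : ℝ) * rootDensity f n| ≤
        C * Real.exp (-c * Real.sqrt (Real.log x))) ∧
      (∀ x : ℝ, 1 ≤ x →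
        |∑ n ∈ Icc 1 ⌊x⌋₊, (μ n : ℝ) * rootDensity f n * Real.log n + batemanHornConst ![f]| ≤
          C * Real.exp (-c * Real.sqrt (Real.log x))) := by
  obtain ⟨c₀, c, C, hc, hC, hS, hRlog, -⟩ := moebius_rootDensity_sums_aux hirr hdeg
  -- `![f]` is a Bateman–Horn system
  have hsys : IsBatemanHornSystem ![f] := by
    refine ⟨fun i => ?_, fun i => ?_, fun i j hij => ?_, fun p hp => hnfd p hp⟩
    · fin_cases i; exact hirr
    · fin_cases i; exact hlc
    · exact absurd (Subsingleton.elim i j) hij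
  obtain ⟨hH, hHpos⟩ := IsBatemanHornSystem.hasBatemanHornConst_holds hsys
  set H := batemanHornConst ![f] with hHdef
  -- the limit of the log-weighted sums is `-H` (Friedlander–Iwaniec (1.13)–(1.14))
  obtain ⟨B, hB1, hB⟩ := exists_rootCount_prime_le hirr.ne_zero
  have h18 : ∃ K : ℝ, ∀ p : ℕ, p.Prime →
      0 ≤ rootDensity f p ∧ rootDensity f p < 1 ∧ rootDensity f p ≤ K / p := by
    refine ⟨B, fun p hp => ⟨rootDensity_nonneg f p, ?_, ?_⟩⟩
    · have hp0 : (0 : ℝ) < p := by exact_mod_cast hp.pos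
      rw [rootDensity_apply, div_lt_one hp0]
      exact_mod_cast hnfd p hp
    · rw [rootDensity_apply]
      exact div_le_div_of_nonneg_right (hB p hp) (Nat.cast_nonneg _)
  have h19 := sum_primesLE_rootDensity_loglog hirr hdeg
  have hprod : Tendsto (fun x : ℕ => ∏ p ∈ Nat.primesLE x,
      (1 - rootDensity f p) / (1 - (p : ℝ)⁻¹)) atTop (𝓝 H) := by
    have hH' : Tendsto (batemanHornPartial ![f]) atTop (𝓝 H) := hH
    refine hH'.congr fun x => ?_
    unfold batemanHornPartial
    refine Finset.prod_congr rfl fun p _ => ?_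
    rw [Fintype.card_fin, pow_one, rootDensity_apply]
    simp only [div_eq_mul_inv, one_mul]
    ring
  have hlim₁ := fi_moebius_density_log_sum_holds (rootDensity f) (isMultiplicative_rootDensity f)
    h18 h19 H hprod
  -- the limit is also `-c₀`
  have hlim₂ : Tendsto (fun N : ℕ => ∑ b ∈ Icc 1 N, (μ b : ℝ) * rootDensity f b * Real.log b)
      atTop (𝓝 (-c₀)) := by
    have hdecay : Tendsto (fun N : ℕ => C * Real.exp (-c * Real.sqrt (Real.log N))) atTop
        (𝓝 (C * 0)) := by
      refine Tendsto.const_mul C (Real.tendsto_exp_atBot.comp ?_)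
      have h1 : Tendsto (fun N : ℕ => Real.sqrt (Real.log N)) atTop atTop :=
        Real.tendsto_sqrt_atTop.comp (Real.tendsto_log_atTop.comp tendsto_natCast_atTop_atTop)
      exact h1.const_mul_atTop_of_neg (by linarith : -c < 0)
    rw [mul_zero] at hdecay
    refine tendsto_sub_nhds_zero_iff.mp ?_
    refine squeeze_zero_norm' ?_ hdecay
    filter_upwards [eventually_ge_atTop 1] with N hN
    rw [Real.norm_eq_abs, sub_neg_eq_add]
    have := hRlog N (by exact_mod_cast hN)
    rwa [Nat.floor_natCast] at this
  have hc₀ : c₀ = H := by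
    have := tendsto_nhds_unique hlim₁ hlim₂
    linarith
  refine ⟨hHpos, c, C, hc, hC, hS, fun x hx => ?_⟩
  rw [← hc₀]
  exact hRlog x hx
end Summit.Parity.BatemanHorn.Theorems.TypeIMainTerm

end
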